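/-
Copyright (c) 2026 the pub-hodgecm-mathlib formalisation cell (harness21).  Prover seat hodgecm-mathlib-K2E4-p11 (g7): Track B «K2-LIT»,
#184♮ = hLiu418 = stmt-HodgeConjecture-24832; Road Φ of socket #41, Φ9 consumer sheet ROW G2 — the per-place glue (LEAD F0P6-plan (g14) BATCH #47 (1),
desk K2Liu-p12 (g4)), EDITION 2 as a NEW file: the integrability letter `hint` of ★ `K2LiuGoodPlaceLocalFactor` DISCHARGED on `1 < re s`.
-/
import Summits.HodgeConjecture.HodgeConjecture.Theorems.K2LiuGoodPlaceLocalFactor          -- ★ (this seat): `integral_unipDeltaLoc_lambdaLoc_eq` (+ ★ B4∕B2∕B1, ★ file 1, ★ `isSphericalSection_lambdaLoc`)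
import Summits.HodgeConjecture.HodgeConjecture.Theorems.K2LiuSiegelIntertwiningIntegrable   -- ★ V1c (K2Liu-p09): `integrable_weylDelta_mul` (smooth Siegel sections, `1 < re s`)
import HarnessLib

/-!
# Crux `HLiu418`, Road Φ of socket #41, ROW G2's PER-PLACE GLUE, ED. 2 — `K2LiuGoodPlaceLocalFactorIntegrable`: THE LETTER `hint` PAID ON `1 < re s`
# and row G1's local factor at a good unimodular place with only the good-place ∕ index ∕ parity letters visible

Cell `hodgecm-mathlib`, crux item hLiu418 = `stmt-HodgeConjecture-24832`, route of record `HCCMUnconditional`; squad K2 ∕ K2Liu, road `K2_Liu`,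
socket #41 `sig_K2LiuSiegelEisensteinContinuation`, Road Φ; Φ9 consumer sheet row G2 (desk K2Liu-p12 (g4) 15:03:44Z: «`hint` = integrability on `1 < re s` from ★
`K2LiuSiegelIntertwiningIntegrable.integrable_weylDelta_mul` (n = 2, smooth Siegel sections, `|ψ| = 1`) transported along ★ B1 `unipDeltaLoc_eq_unipDeltaLocal` + ★ B2»).
THEOREMS ONLY (no `def`, no `instance`, no `notation`, no named-fact hypothesis, no `sorry`); lane `--supports stmt-HodgeConjecture-24832 --as helper` (count-neutral
helper; closes no socket by itself).

THE MATHEMATICS [KudlaSweet1997, §1], [Casselman1980, §3], [Weil1965, §37].  For `1 < re s` and a unitary unramified `χ`, the pulled-back spherical section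
`u ↦ Λ_{s,v}(w_Δ u)` is integrable on `N_Δ(L⁺_v)` (★ V1c `integrable_weylDelta_mul` for the smooth Siegel section `Λ_{s,v}` — ★ `isSphericalSection_lambdaLoc` ∘ ★
`IsSphericalSection.isLocalSiegelSection ∕ .isSmooth` — on the literal subgroup `unipDeltaLocal`, moved to ANY subgroup with the same carrier by `subst`, §1, hence to `unipDeltaLoc v` by
★ B1 `unipDeltaLoc_eq_unipDeltaLocal`); pushing forward along the coordinate homeomorphism `ψc : N_Δ(L⁺_v) ≃ₜ Skew` (inverse `t ↦ n(t)`, ★ B2 `coe_symm_apply_eq_nElem`) and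
multiplying by the unit-modulus continuous weight `ψ_v(−τ tr(β t))` keeps integrability (Mathlib `integrable_map_equiv`, `Integrable.mul_bdd`, `Circle.norm_coe`): this is EXACTLY
the letter `hint` of ★ `K2LiuGoodPlaceLocalFactor.integral_unipDeltaLoc_lambdaLoc_eq`.
* §1 (generic local frame) `integrable_weylDelta_mul_of_eq` — ★ V1c on any subgroup `N′ = unipDeltaLocal` (`subst`).
* §2 (CM frame) `integrable_lambdaLoc_weylDelta` (★ V1c on `unipDeltaLoc v`) and **`integrable_skew_lambdaLoc`** — the letter `hint` on `1 < re s`.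
* §3 HEAD **`integral_unipDeltaLoc_lambdaLoc_eq_of_one_lt_re`** — ★ `integral_unipDeltaLoc_lambdaLoc_eq` with `hint` discharged: on `1 < re s`,
  `∫ conj ψ_S(ι_v y)·Λ_{s,v}((w_Δ)_v y) dν = ν(N_Δ ∩ K_v)·((1 − q_v^{−(2s+1)})·(1 − ε(ϖ_v)·q_v^{−(2s+2)}))` (then on #41's window by the identity principle at the tie, as the desk notes).
VISIBLE LETTERS: those of ★ `K2LiuGoodPlaceLocalFactor` minus `hint`, plus the unitarity `hχ1 : ‖χ_w(x)‖ = 1` of the local components (★ V1c's `hχ`).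
HONEST LABEL.  Count-neutral helper; it retires nothing by itself: `HC_CM` is proved only modulo the 7 printed citations (2 remaining named inputs:
hLiu418 = `stmt-HodgeConjecture-24832`, h413 = `stmt-HodgeConjecture-24833`) until rung 0 closes.

## References
* [KudlaSweet1997] S. Kudla, W. J. Sweet, *Degenerate principal series representations for U(n,n)*, Israel J. Math. 98 (1997), §1.
* [Casselman1980] W. Casselman, Compositio Math. 40 (1980), §3.   * [Weil1965] A. Weil, *L'intégration dans les groupes topologiques* (1965), §37.
* [Shimura1997] G. Shimura, CBMS 93 (1997), §18.1 (18.4).   * [Liu2011] Y. Liu, Algebra Number Theory 5 (2011), §2A (2-10).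
-/

set_option autoImplicit false
-- the mandated namespace repeats the single-problem summit's segment (`HodgeConjecture.HodgeConjecture`)
set_option linter.dupNamespace false

noncomputable section

open scoped Matrix ComplexConjugate NNReal ENNReal
open NumberField IsDedekindDomain Matrix MeasureTheory Set
open Literature.NumberTheory.Automorphic Literature.NumberTheory.Automorphic.UnitaryGroup Literature.NumberTheory.GaloisRepresentations
open Literature.NumberTheory.GaloisRepresentations.IsNonarchimedeanLocalField
open Literature.NumberTheory.GelbartRogawski1991 Literature.NumberTheory.GelbartRogawski1991.GRConstruction
open Literature.NumberTheory.GelbartRogawski1991.AdaptedBlocks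
open Literature.NumberTheory.GelbartRogawski1991.UnitaryDualPair Literature.NumberTheory.GelbartRogawski1991.UnitaryDualPair.LocalSplitting
open Literature.NumberTheory.K2Lit Literature.NumberTheory.K2Lit.SiegelDoubled Literature.NumberTheory.K2Lit.LocalSiegelDoubled
open Summit.HodgeConjecture.HodgeConjecture.Cruxes.HLiu418.K2LiuSiegelUnipotentFourierDefs
open Summit.HodgeConjecture.HodgeConjecture.Cruxes.HLiu418.K2LiuSiegelUnipotentLocalDefs
open Summit.HodgeConjecture.HodgeConjecture.Cruxes.HLiu418.K2LiuUnipDeltaLocBridge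
open Summit.HodgeConjecture.HodgeConjecture.Cruxes.HLiu418.K2LiuUnipDeltaLocalHaarTransport
open Summit.HodgeConjecture.HodgeConjecture.Cruxes.HLiu418.K2LiuSphericalSectionLambdaLoc (isSphericalSection_lambdaLoc)
open Summit.HodgeConjecture.HodgeConjecture.Cruxes.HLiu418.K2LiuSiegelIntertwiningIntegrable (integrable_weylDelta_mul)
open Summit.HodgeConjecture.HodgeConjecture.Cruxes.HLiu418.K2LiuGoodPlaceLocalFactor (integral_unipDeltaLoc_lambdaLoc_eq)

namespace Summit.HodgeConjecture.HodgeConjecture.Cruxes.HLiu418.K2LiuGoodPlaceLocalFactorIntegrable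

/-! ## §1 Generic local frame: ★ V1c on any subgroup with the carrier of `N_Δ(F_v)` -/

section Generic

variable (F : Type) [Field F] [NumberField F] (E : Type) [Field E] [NumberField E] [Algebra F E]
  [Algebra.IsQuadraticExtension F E] (c : E ≃ₐ[F] E)
  {δ : E} (hcδ : c δ = -δ) (hδ : δ ≠ 0) {d : F} (hd : δ * δ = algebraMap F E d) (v : HeightOneSpectrum (𝓞 F))
  {T₂ : Matrix (Fin 2) (Fin 2) F} (hT₂ : T₂.IsSymm) {J₂D : Matrix (Fin (2 + 2)) (Fin (2 + 2)) E} (hJ₂D : J₂D = (gramD F 2 T₂).map (algebraMap F E))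

include hcδ hδ hd hT₂ in
/-- **★ V1c `integrable_weylDelta_mul` ON ANY SUBGROUP `N′` EQUAL TO `unipDeltaLocal`** (`subst`): for `1 < re s`, `χ_v` unitary and a smooth Siegel section `f₀`,
`u ↦ f₀(w_Δ u h)` is integrable for every Haar measure on `N′` — so that measures given on the global-comap subgroup `unipDeltaLoc v` (★ B1 `unipDeltaLoc_eq_unipDeltaLocal`)
are served without a transport of measures. [cite: KudlaSweet1997, §1] [cite: Casselman1980, §3] -/
theorem integrable_weylDelta_mul_of_eq (hT₂d : IsUnit T₂.det)
    {N' : Subgroup (UnitaryGroup.localPi E c (2 + 2) J₂D v)} (hN' : N' = unipDeltaLocal F E c v 2 (JD := J₂D))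
    [MeasurableSpace N'] [BorelSpace N'] (νN : Measure N') [νN.IsHaarMeasure]
    {χv : ∀ w : PlacesOver E v, (w.1.adicCompletion E)ˣ →* ℂˣ} (hχ : ∀ (w' : PlacesOver E v) (x : (w'.1.adicCompletion E)ˣ), ‖((χv w' x : ℂˣ) : ℂ)‖ = 1)
    {s : ℂ} (hs : 1 < s.re) {f₀ : UnitaryGroup.localPi E c (2 + 2) J₂D v → ℂ} (hf₀ : IsLocalSiegelSection F E c hcδ hδ hd v 2 hT₂ hJ₂D χv s f₀) (hsm₀ : IsSmooth F E c v 2 f₀)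
    (h : UnitaryGroup.localPi E c (2 + 2) J₂D v) :
    Integrable (fun u : N' => f₀ (weylDelta F E c v 2 hJ₂D (T₀ := T₂) * (u : UnitaryGroup.localPi E c (2 + 2) J₂D v) * h)) νN := by
  subst hN'
  exact integrable_weylDelta_mul F E c hcδ hδ hd v hT₂ hJ₂D hT₂d νN hχ hs hf₀ hsm₀ h

end Generic

/-! ## §2 The CM frame: the letter `hint` of ★ `K2LiuGoodPlaceLocalFactor` on `1 < re s` -/

section CM

variable (L : Type) [Field L] [NumberField L] [IsCMField L]
variable {N M : ℕ} (e : Fin N × Fin M ≃ Fin 2)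
  (dV : Fin N → L) (hdV : ∀ i, IsCMField.complexConj L (dV i) = dV i)
  (dW : Fin M → L) (hdW : ∀ i, IsCMField.complexConj L (dW i) = dW i)
  (hdV0 : ∀ i, dV i ≠ 0) (hdW0 : ∀ i, dW i ≠ 0)
  (v : HeightOneSpectrum (𝓞 (Fp L)))
  {π : v.adicCompletion (Fp L)} (hπ : Valued.v π = WithZero.exp (-1 : ℤ))
  (hπw : ∀ w : UnitaryGroup.PlacesOver L v, Valued.v (toPlace v w π) = WithZero.exp (-1 : ℤ))

variable [MeasurableSpace ↥(unipDeltaLoc L e dV hdV dW hdW v)] [BorelSpace ↥(unipDeltaLoc L e dV hdV dW hdW v)]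
  (Sk : AddSubgroup (Matrix (Fin 2) (Fin 2) (LocalRing L v)))
  (hSk : ∀ t, t ∈ Sk ↔ (t.map (conjLocal L (IsCMField.complexConj L) v))ᵀ * gramS (Fp L) L v 2 (gramR L e dV hdV dW hdW) + gramS (Fp L) L v 2 (gramR L e dV hdV dW hdW) * t = 0)
  [MeasurableSpace Sk] [BorelSpace Sk]
  (ψc : ↥(unipDeltaLoc L e dV hdV dW hdW v) ≃ₜ Sk) (hψc : ∀ u, (ψc u).1 = blkB (matA (Fp L) L (IsCMField.complexConj L) v 2 (u : UnitaryGroup.localPi L (IsCMField.complexConj L) (2 + 2) (hermD L e dV hdV dW hdW) v)))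
  (ν : Measure ↥(unipDeltaLoc L e dV hdV dW hdW v)) [ν.IsHaarMeasure]
  [MeasurableSpace (v.adicCompletion (Fp L))] [BorelSpace (v.adicCompletion (Fp L))] (μF : Measure (v.adicCompletion (Fp L))) [μF.IsAddHaarMeasure]
  -- the unramified Hecke character and the Fourier index
  (χ : HeckeCharacter L) (hχ : ∀ w : UnitaryGroup.PlacesOver L v, χ.IsUnramifiedAt w.1)
  (hχur : ∀ (w : UnitaryGroup.PlacesOver L v) (x : (w.1.adicCompletion L)ˣ), Valued.v (x : w.1.adicCompletion L) = 1 → χ.localComponent w.1 x = 1)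
  (S : Matrix (Fin 2) (Fin 2) L)
  {β βinv : Matrix (Fin 2) (Fin 2) (LocalRing L v)} (hβdef : β = -(⅟(2 : LocalRing L v) • S.map (algebraMap L (LocalRing L v))))
  (hβs : (β.map (conjLocal L (IsCMField.complexConj L) v))ᵀ * gramS (Fp L) L v 2 (gramR L e dV hdV dW hdW) + gramS (Fp L) L v 2 (gramR L e dV hdV dW hdW) * β = 0) (hββ : β * βinv = 1)
  (hβ0 : ∀ i j (w : UnitaryGroup.PlacesOver L v), Valued.v (β i j w) ≤ Valued.v (toPlace v w π) ^ (0 : ℤ))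
  (hβinv0 : ∀ i j (w : UnitaryGroup.PlacesOver L v), Valued.v (βinv i j w) ≤ Valued.v (toPlace v w π) ^ (0 : ℤ))
  -- the additive character of `L⁺_v`, the local trace, B3's letter
  {ψ : AddChar (v.adicCompletion (Fp L)) Circle} (hψ : Continuous ψ) (hdψ : ψ.HasConductorExp 0)
  {τ : LocalRing L v → v.adicCompletion (Fp L)} (hτ : ∀ r, toLocalRing L v (τ r) = r + conjLocal L (IsCMField.complexConj L) v r) (hτadd : ∀ r s, τ (r + s) = τ r + τ s)
  (hτs : ∀ (z : v.adicCompletion (Fp L)) (r : LocalRing L v), τ (toLocalRing L v z * r) = z * τ r) (hτc : Continuous τ)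
  (hΨ : ∀ x : LocalRing L v, (∏ w : UnitaryGroup.PlacesOver L v, (adeleAddChar L).adicComponent w.1 (x w)) = ψ (τ x))
  -- the good-place letters of ★ E7 at `T₀ := gramR`, `δ := imagUnit L`
  (h2v : ∀ w : UnitaryGroup.PlacesOver L v, ValuativeRel.valuation (w.1.adicCompletion L) (2 : w.1.adicCompletion L) = 1)
  (hT : ∀ (w : UnitaryGroup.PlacesOver L v) (i j : Fin 2),
    ValuativeRel.valuation (w.1.adicCompletion L) (algebraMap L (w.1.adicCompletion L) (algebraMap (Fp L) L (gramR L e dV hdV dW hdW i j))) ≤ 1)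
  (hTinv : ∀ (w : UnitaryGroup.PlacesOver L v) (i j : Fin 2),
    ValuativeRel.valuation (w.1.adicCompletion L) (algebraMap L (w.1.adicCompletion L) (algebraMap (Fp L) L ((gramR L e dV hdV dW hdW)⁻¹ i j))) ≤ 1)
  (hTb : ∀ i j (w : UnitaryGroup.PlacesOver L v), Valued.v (gramS (Fp L) L v 2 (gramR L e dV hdV dW hdW) i j w) ≤ Valued.v (toPlace v w π) ^ (0 : ℤ))
  (hTib : ∀ i j (w : UnitaryGroup.PlacesOver L v), Valued.v ((gramS (Fp L) L v 2 (gramR L e dV hdV dW hdW))⁻¹ i j w) ≤ Valued.v (toPlace v w π) ^ (0 : ℤ))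
  (hϖ0 : ∀ w : UnitaryGroup.PlacesOver L v, toPlace v w π ≠ 0)
  (h2F : Valued.v (2 : v.adicCompletion (Fp L)) = 1)
  {ε₁ : LocalRing L v} (hεσ : conjLocal L (IsCMField.complexConj L) v ε₁ = -ε₁) (hεint : ∀ w : UnitaryGroup.PlacesOver L v, Valued.v (ε₁ w) ≤ 1)
  (hε : ∀ w : UnitaryGroup.PlacesOver L v, Valued.v (toPlace v w π) ^ (0 : ℤ) ≤ Valued.v ((2 * ε₁) w))
  (h2 : ∀ w : UnitaryGroup.PlacesOver L v, Valued.v (toPlace v w π) ^ (0 : ℤ) ≤ Valued.v ((2 : LocalRing L v) w))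
  (w₀ : UnitaryGroup.PlacesOver L v)
  (hχ1 : ∀ (w : UnitaryGroup.PlacesOver L v) (x : (w.1.adicCompletion L)ˣ), ‖((χ.localComponent w.1 x : ℂˣ) : ℂ)‖ = 1)

omit [MeasurableSpace (v.adicCompletion (Fp L))] [BorelSpace (v.adicCompletion (Fp L))] in
include hdV0 hdW0 hχ hχ1 in
set_option maxHeartbeats 800000 in -- MEASURED: farm-direct cost ∈ (200 000, 400 000] (probes 200000 ✗ ∕ 400000 ✓) — the K2Lit datum's binder telescope (★ B4's class); scoped 2×, plain `exact`
/-- **`u ↦ Λ_{s,v}(w_Δ u)` IS INTEGRABLE ON `N_Δ(L⁺_v) = unipDeltaLoc v`** for `1 < re s` (★ V1c via §1 at ★ B1 `unipDeltaLoc_eq_unipDeltaLocal`; `Λ_{s,v}` smooth Siegel by ★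
`isSphericalSection_lambdaLoc`; `h := 1`). [cite: KudlaSweet1997, §1] [cite: Casselman1980, §3] -/
theorem integrable_lambdaLoc_weylDelta {s : ℂ} (hs : 1 < s.re) :
    Integrable (fun y : ↥(unipDeltaLoc L e dV hdV dW hdW v) => LambdaLoc L e dV hdV dW hdW v χ s (weylDelta (Fp L) L (IsCMField.complexConj L) v 2 (hermD_eq_map_gramD L e dV hdV dW hdW) * (y : UnitaryGroup.localPi L (IsCMField.complexConj L) (2 + 2) (hermD L e dV hdV dW hdW) v))) ν := by
  haveI : Algebra.IsQuadraticExtension (Fp L) L := IsCMField.isQuadraticExtension L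
  have hsph := isSphericalSection_lambdaLoc L e dV hdV dW hdW v χ s hχ
  have hI := integrable_weylDelta_mul_of_eq (Fp L) L (IsCMField.complexConj L) (complexConj_imagUnit L) (imagUnit_ne_zero L) (imagUnit_mul_self L) v (gramR_isSymm L e dV hdV dW hdW) (hermD_eq_map_gramD L e dV hdV dW hdW)
    (isUnit_det_gram (Fp L) e (isUnit_det_realDiagonal L dV hdV hdV0) (isUnit_det_realDiagonal L dW hdW hdW0)) (unipDeltaLoc_eq_unipDeltaLocal L e dV hdV dW hdW v) ν hχ1 hs
    hsph.isLocalSiegelSection hsph.isSmooth 1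
  exact hI.congr (Filter.Eventually.of_forall fun y => by simp only [mul_one])

omit [MeasurableSpace (v.adicCompletion (Fp L))] [BorelSpace (v.adicCompletion (Fp L))] in
include hdV0 hdW0 hSk hψc hχ hχ1 hψ hτc in
set_option maxHeartbeats 800000 in -- MEASURED: farm-direct cost ∈ (200 000, 400 000] (probes 200000 ✗ ∕ 400000 ✓) — ★ B2 transport in the K2Lit frame (★ B4's class); scoped 2×, no search tactics
/-- **THE LETTER `hint` ON `1 < re s`**: the Skew-carrier integrand `t ↦ Λ_{s,v}(w_Δ n(t)) · ψ_v(−τ tr(β t))` is integrable against `ψc_*ν` — ★ V1c (§1 at `N′ := unipDeltaLoc v`, ★ B1;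
`f₀ := Λ_{s,v}` smooth Siegel by ★ `isSphericalSection_lambdaLoc`; `h := 1`) transported along `ψc` (Mathlib `integrable_map_equiv`; `n(ψc y) = y` by ★ B2 `coe_symm_apply_eq_nElem`)
and multiplied by the unit-modulus continuous weight (`Integrable.mul_bdd`, `Circle.norm_coe`). [cite: KudlaSweet1997, §1] [cite: Casselman1980, §3] [cite: Weil1965, §37] -/
theorem integrable_skew_lambdaLoc {s : ℂ} (hs : 1 < s.re) (β : Matrix (Fin 2) (Fin 2) (LocalRing L v)) :
    Integrable (fun t : Sk => LambdaLoc L e dV hdV dW hdW v χ s (weylDelta (Fp L) L (IsCMField.complexConj L) v 2 (hermD_eq_map_gramD L e dV hdV dW hdW) * nElem (Fp L) L (IsCMField.complexConj L) v 2 (hermD_eq_map_gramD L e dV hdV dW hdW) t.1 ((hSk t.1).1 t.2)) *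
      ((ψ (-τ (Matrix.trace (β * t.1))) : Circle) : ℂ)) (Measure.map ψc ν) := by
  haveI : Algebra.IsQuadraticExtension (Fp L) L := IsCMField.isQuadraticExtension L
  have hN := mem_unipDeltaLoc_iff_mem_unipDeltaLocal L e dV hdV dW hdW v
  -- ★ V1c on `unipDeltaLoc v` (★ B1)
  have hI := integrable_lambdaLoc_weylDelta L e dV hdV dW hdW hdV0 hdW0 v ν χ hχ hχ1 hs
  -- transport along `ψc`
  rw [← Homeomorph.toMeasurableEquiv_coe, integrable_map_equiv]
  simp only [Homeomorph.toMeasurableEquiv_coe, Function.comp_def]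
  have hn : ∀ y : ↥(unipDeltaLoc L e dV hdV dW hdW v), nElem (Fp L) L (IsCMField.complexConj L) v 2 (hermD_eq_map_gramD L e dV hdV dW hdW) (ψc y).1 ((hSk (ψc y).1).1 (ψc y).2) = (y : UnitaryGroup.localPi L (IsCMField.complexConj L) (2 + 2) (hermD L e dV hdV dW hdW) v) := fun y => by
    have h := coe_symm_apply_eq_nElem (Fp L) L (IsCMField.complexConj L) v 2 (hermD_eq_map_gramD L e dV hdV dW hdW) hSk ψc hψc (nElem_mem (Fp L) L (IsCMField.complexConj L) v 2 (hermD_eq_map_gramD L e dV hdV dW hdW) hN hSk) (ψc y)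
    rw [Homeomorph.symm_apply_apply] at h
    exact h.symm
  refine Integrable.mul_bdd (c := 1) ?_ ?_ ?_
  · refine hI.congr (Filter.Eventually.of_forall fun y => ?_)
    simp only [hn]
  · refine Continuous.aestronglyMeasurable ?_
    refine continuous_subtype_val.comp (hψ.comp ((hτc.comp ?_).neg))
    exact (continuous_const.matrix_mul (continuous_subtype_val.comp ψc.continuous)).matrix_trace
  · exact Filter.Eventually.of_forall fun y => (Circle.norm_coe _).le

/-! ## §3 HEAD: row G1's local factor with `hint` discharged -/

include hdV0 hdW0 hπ hπw hSk hψc μF hχ hχur hχ1 hβdef hβs hββ hβ0 hβinv0 hψ hdψ hτ hτadd hτs hτc hΨ h2v hT hTinv hTb hTib h2F hεσ hεint hε h2 w₀ in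
set_option maxHeartbeats 800000 in -- MEASURED: farm-direct cost ≤ 400 000 (probe 400000 ✓; ★ `integral_unipDeltaLoc_lambdaLoc_eq`'s application, (200 000, 400 000] class); scoped 2×, plain `exact`
/-- **ROW G1's LOCAL FACTOR AT A GOOD UNIMODULAR PLACE, `1 < re s`, INTEGRABILITY PAID** — ★ `integral_unipDeltaLoc_lambdaLoc_eq` with `hint := integrable_skew_lambdaLoc`:
`∫ conj ψ_S(ι_v y)·Λ_{s,v}((w_Δ)_v y) dν = ν(N_Δ ∩ K_v)·((1 − q_v^{−(2s+1)})·(1 − ε(ϖ_v)·q_v^{−(2s+2)}))` — G1's `hW` at `v` in the half-plane of absolute convergence.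
[cite: Liu2011, §2A (2-10)] [cite: Shimura1997, §18.1 (18.4)] [cite: KudlaSweet1997, §1] -/
theorem integral_unipDeltaLoc_lambdaLoc_eq_of_one_lt_re
    (hδu : ∀ w : UnitaryGroup.PlacesOver L v, Valued.v (algebraMap L (LocalRing L v) (imagUnit L) w) = 1)
    (hunr : Algebra.IsUnramifiedIn (𝓞 L) v.asIdeal)
    (hα : (((∏ w : UnitaryGroup.PlacesOver L v, χ.localComponent w.1 (Units.mk0 (toPlace v w π) (hϖ0 w))) : ℂˣ) : ℂ) = (quadraticHeckeCharCM L).valueAtUniformizer v)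
    {s : ℂ} (hs : 1 < s.re) :
    ∫ y, conj ((unipDeltaChar L e dV hdV dW hdW S (locToAdelic L e dV hdV dW hdW v (y : UnitaryGroup.localPi L (IsCMField.complexConj L) (2 + 2) (hermD L e dV hdV dW hdW) v)) : Circle) : ℂ) *
        LambdaLoc L e dV hdV dW hdW v χ s (weylDelta (Fp L) L (IsCMField.complexConj L) v 2 (hermD_eq_map_gramD L e dV hdV dW hdW) * (y : UnitaryGroup.localPi L (IsCMField.complexConj L) (2 + 2) (hermD L e dV hdV dW hdW) v)) ∂ν =
      (ν.real {u : ↥(unipDeltaLoc L e dV hdV dW hdW v) | (u : UnitaryGroup.localPi L (IsCMField.complexConj L) (2 + 2) (hermD L e dV hdV dW hdW) v) ∈ UnitaryGroup.localInt L (IsCMField.complexConj L) (2 + 2) (hermD L e dV hdV dW hdW) v} : ℂ) *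
        ((1 - (v.residueCard : ℂ) ^ (-(2 * s + 1))) *
          (1 - (quadraticHeckeCharCM L).valueAtUniformizer v * (v.residueCard : ℂ) ^ (-(2 * s + 2)))) :=
  integral_unipDeltaLoc_lambdaLoc_eq L e dV hdV dW hdW hdV0 hdW0 v hπ hπw Sk hSk ψc hψc ν μF χ hχ hχur S hβdef hβs hββ hβ0 hβinv0 hψ hdψ hτ hτadd hτs hτc hΨ
    h2v hT hTinv hTb hTib hϖ0 h2F hεσ hεint hε h2 w₀ hδu hunr hα s
    (integrable_skew_lambdaLoc L e dV hdV dW hdW hdV0 hdW0 v Sk hSk ψc hψc ν χ hχ hψ hτc hχ1 hs β)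

end CM

end Summit.HodgeConjecture.HodgeConjecture.Cruxes.HLiu418.K2LiuGoodPlaceLocalFactorIntegrable

end
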